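import Summits.BirchSwinnertonDyer.BirchSwinnertonDyer.Theorems.AdditiveBranchIMCTwistFieldBaseChangeDoors
import Summits.BirchSwinnertonDyer.BirchSwinnertonDyer.Theorems.AdditiveBranchIMCTwistFieldBaseChangeBounded
import HarnessLib

/-!
# Crux `GordTwoRankZeroOffCaseOne` (route `AdditiveBranchIMC`, item 19357), lane k1-c2x gen 2: the
# twist-field road in DESCENDED shape — Part 7: the rank-0 doors on cell (G-ord, `e = 2`) at ANY image
# with the torsion binder discharged by Delbourgo 2002 (A) (`p ≥ 5` and `p = 3`, non-CM)

Sequel of `…TwistFieldBaseChangeDoors` (Part 3) and `…Bounded` (Part 6). Cell `bsd-addord`, seat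
`bsd-addord-k1-c2x`; the lane's second (thin) file inside the route cone (k1-c2's p418190 §2 transports
import the route file). HONEST FRAMING: theorems only; every published input is a DISPLAYED named-fact
binder (Kato 2004 Thm. 17.4 `kato_divisibility` (1)(2) — NO image hypothesis; Rohrlich 1984
`padicLFunction_ne_zero`; Delbourgo 2002 Thm. (A) `Delbourgo2002.mainTheorem` / `mainTheorem_three` —
torsion of `X(W/ℚ_∞)`, Hypothesis (G) = `TypeGOrd`, at `3` discharged by additive-p2's bridge; Delbourgo
1998 Prop. 4 intrinsic; Pal 2012 Thm. 3.2; GZK; modularity); `GordTwistBaseChangeLower{Even,Odd}At W p`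
is this lane's typed CONJECTURE (OPEN, nothing asserted); the unit coefficient is a displayed per-pair
CERTIFICATE; nothing is booked; BSD is not proved by any of this.

* **`missingLowerBoundAt_cellGordTwo_rankZero_of_baseChange_of_hasUnitContent_of_delbourgo`** (even,
  `p ≥ 5`) / **`…_of_baseChangeOdd_of_hasUnitContent_of_delbourgo`** (odd, `p ≥ 7`) /
  **`…_of_baseChangeOdd_of_hasUnitContent_three`** (`p = 3`): on a NON-CM pair of cell (G-ord, `e = 2`)
  in analytic rank `0`, for ANY image of `ρ̄_{W,p}` (irreducible non-surjective rows included),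
  `ord_p #Ш(E)_an ≤ ord_p #Ш(E)` ⟸ (BC-Gord) + ONE unit coefficient of the Néron-normalised branch series
  of the twist model + NAMED FACTS ONLY. (CM pairs of the cell are CornerF / Burungale–Flach 2024 in the
  partition and keep Part 3's door with `hT` displayed.)

References: D. Delbourgo, J. Number Theory 95 (2002) Thm. (A) (p. 40) [Delbourgo2002]; D. Delbourgo,
Compositio 113 (1998) Prop. 4 [Delbourgo1998]; V. Pal, Proc. AMS 140 (2012) Thm. 3.2 [Pal2012]; K. Kato,
Astérisque 295 (2004) Thm. 17.4 [Kato2004Asterisque]; D. Rohrlich, Invent. Math. 75 (1984)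
[RohrlichInventiones1984]; Greenberg–Vatsal, Invent. Math. 142 (2000) p. 2 (2) [GreenbergVatsal2000].
-/

set_option autoImplicit false
set_option linter.dupNamespace false

noncomputable section

open scoped Classical MatrixGroups ModularForm

open CongruenceSubgroup WeierstrassCurve Literature.NumberTheory.EllipticCurves
  Literature.NumberTheory.EllipticCurves.ModularForms
  Literature.NumberTheory.EllipticCurves.Rank1Residual
  Literature.NumberTheory.EllipticCurves.Rank1Residual.Typed
  Literature.NumberTheory.GaloisRepresentations
  Literature.NumberTheory.EllipticCurves.GreenbergVatsal2000

namespace Summit.BirchSwinnertonDyer.BirchSwinnertonDyer.Theorems.AdditiveBranchIMCTwistField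

open Summit.BirchSwinnertonDyer.Rank1Residual.Additive

section DoorsFacts

variable {W : WeierstrassCurve ℚ} [W.IsElliptic] [W.IsGloballyMinimal] {p : ℕ} [hp : Fact p.Prime]

/-- **Door, `p ≡ 1 (mod 4)`, `p ≥ 5`, non-CM, ANY image: the rank-`0` lower half on cell (G-ord, `e = 2`)
⟸ (BC-Gord, even) + ONE unit coefficient + named facts only** (Part 3's door with `hT` discharged by
`Delbourgo2002.mainTheorem` (A); cell binders give `Addv`, `TypeGOrd`).
[cite: Delbourgo2002, Theorem (A) (p. 40)] [cite: Delbourgo1998, Prop. 4 (p. 144)] [cite: Pal2012, Thm. 3.2]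
[cite: Kato2004Asterisque, Thm. 17.4 (1)(2) (p. 273)] [cite: RohrlichInventiones1984, Theorem (p. 409)] -/
theorem missingLowerBoundAt_cellGordTwo_rankZero_of_baseChange_of_hasUnitContent_of_delbourgo
    (hDelG : Delbourgo1998.prop4_rankZero_constantCoeff_eq_unit_mul_of_potGoodOrd)
    (hPal : Pal2012.thm32_sqrt_mul_realPeriodRat_twist_eq_of_prime_one_mod_four)
    (hGZK : rank_eq_analyticRank_of_analyticRank_le_one) (hmod : hasEntireLFunction_rat)
    (hmodD : nonempty_modularParametrizationData) (hDel : Delbourgo2002.mainTheorem)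
    (hkato : ∀ (V : WeierstrassCurve ℚ) [V.IsElliptic] [V.IsGloballyMinimal] (κ : ZpExtension ℚ p)
      (γ : Field.absoluteGaloisGroup ℚ) (N : ℕ) [NeZero N] (f : CuspForm (Gamma0 N) 2),
      kato_divisibility V p (κ := κ) (γ := γ) (f := f))
    (hR : ∀ (V : WeierstrassCurve ℚ) [V.IsElliptic] [V.IsGloballyMinimal] (N : ℕ) [NeZero N]
      (f : CuspForm (Gamma0 N) 2), padicLFunction_ne_zero (W := V) (p := p) (f := f))
    (hc : N10.CellGordTwo W p) (hp5 : 5 ≤ p) (hp4 : p % 4 = 1) (hcm : ¬ W.HasCM)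
    (hr : W.analyticRank = 0) (hBC : GordTwistBaseChangeLowerEvenAt W p)
    (hU : ∀ (V : WeierstrassCurve ℚ) [V.IsElliptic] [V.IsGloballyMinimal] {N : ℕ} [NeZero N]
      (f : CuspForm (Gamma0 N) 2) (ϖ : ℚ), (∃ C : VariableChange ℚ, C • V.quadraticTwist (p : ℚ) = W) →
      GoodOrd V p → IsNewformOf V f → (ϖ : ℝ) * V.realPeriodRat = plusPeriod f →
      ∃ b : IwasawaAlgebra p, iwasawaToPowerSeries p b =
        PowerSeries.C ((ϖ : ℚ) : ℚ_[p]) * padicLFunctionBranch f (unitRoot V p : ℚ_[p]) (p / 2) ∧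
        HasUnitContent b) :
    MissingLowerBoundAt W p :=
  missingLowerBoundAt_cellGordTwo_rankZero_of_baseChange_of_hasUnitContent hDelG hPal hGZK hmod hmodD
    hkato hR (fun _ _ D hκ hγ ↦ Delbourgo2002.mainTheorem.isTorsion hDel hp5 hcm hc.2.1 hc.2.2.1 hκ hγ D)
    hc hp4 hr hBC hU

/-- **Door, `p ≡ 3 (mod 4)`, `p ≥ 5` (so `p ≥ 7`), non-CM, ANY image: the rank-`0` lower half on cell
(G-ord, `e = 2`) ⟸ (BC-Gord, odd) + ONE unit coefficient + named facts only.**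
[cite: Delbourgo2002, Theorem (A) (p. 40)] [cite: Delbourgo1998, Prop. 4 (p. 144)]
[cite: Kato2004Asterisque, Thm. 17.4 (1)(2) (p. 273)] [cite: RohrlichInventiones1984, Theorem (p. 409)] -/
theorem missingLowerBoundAt_cellGordTwo_rankZero_of_baseChangeOdd_of_hasUnitContent_of_delbourgo
    (hDelG : Delbourgo1998.prop4_rankZero_constantCoeff_eq_unit_mul_of_potGoodOrd)
    (hGZK : rank_eq_analyticRank_of_analyticRank_le_one) (hmod : hasEntireLFunction_rat)
    (hmodD : nonempty_modularParametrizationData) (hDel : Delbourgo2002.mainTheorem)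
    (hkato : ∀ (V : WeierstrassCurve ℚ) [V.IsElliptic] [V.IsGloballyMinimal] (κ : ZpExtension ℚ p)
      (γ : Field.absoluteGaloisGroup ℚ) (N : ℕ) [NeZero N] (f : CuspForm (Gamma0 N) 2),
      kato_divisibility V p (κ := κ) (γ := γ) (f := f))
    (hR : ∀ (V : WeierstrassCurve ℚ) [V.IsElliptic] [V.IsGloballyMinimal] (N : ℕ) [NeZero N]
      (f : CuspForm (Gamma0 N) 2), padicLFunction_ne_zero (W := V) (p := p) (f := f))
    (hc : N10.CellGordTwo W p) (hp5 : 5 ≤ p) (hp4 : p % 4 = 3) (hcm : ¬ W.HasCM)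
    (hr : W.analyticRank = 0) (hBC : GordTwistBaseChangeLowerOddAt W p)
    (hU : ∀ (V : WeierstrassCurve ℚ) [V.IsElliptic] [V.IsGloballyMinimal] {N : ℕ} [NeZero N]
      (f : CuspForm (Gamma0 N) 2) (ϖ : ℚ),
      (∃ C : VariableChange ℚ, C • V.quadraticTwist (-(p : ℚ)) = W) →
      GoodOrd V p → IsNewformOf V f → (ϖ : ℝ) * V.imaginaryPeriodRat = minusPeriod f →
      ∃ b : IwasawaAlgebra p, iwasawaToPowerSeries p b =
        PowerSeries.C ((ϖ : ℚ) : ℚ_[p]) * padicLFunctionMinusBranch f (unitRoot V p : ℚ_[p]) (p / 2) ∧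
        HasUnitContent b) :
    MissingLowerBoundAt W p :=
  missingLowerBoundAt_cellGordTwo_rankZero_of_baseChangeOdd_of_hasUnitContent hDelG hGZK hmod hmodD hkato hR
    (fun _ _ D hκ hγ ↦ Delbourgo2002.mainTheorem.isTorsion hDel hp5 hcm hc.2.1 hc.2.2.1 hκ hγ D)
    hc hp4 hr hBC hU

end DoorsFacts

section DoorsFactsThree

variable {W : WeierstrassCurve ℚ} [W.IsElliptic] [W.IsGloballyMinimal] [hp : Fact (Nat.Prime 3)]

/-- **Door at `p = 3`, non-CM, ANY image: the rank-`0` lower half on cell (G-ord, `e = 2`) at `3` ⟸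
(BC-Gord, odd) + ONE unit coefficient + named facts only** — torsion of `X(W/ℚ_∞)` by
`Delbourgo2002.mainTheorem_three` (A) through additive-p2's bridge `TypeGOrd.isTorsion_three_of_delbourgo2002`.
[cite: Delbourgo2002, Theorem (A) (p. 40), Hypothesis (p. 39)] [cite: Delbourgo1998, Prop. 4 (p. 144)]
[cite: Kato2004Asterisque, Thm. 17.4 (1)(2) (p. 273)] [cite: RohrlichInventiones1984, Theorem (p. 409)] -/
theorem missingLowerBoundAt_cellGordTwo_rankZero_of_baseChangeOdd_of_hasUnitContent_three
    (hDelG : Delbourgo1998.prop4_rankZero_constantCoeff_eq_unit_mul_of_potGoodOrd)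
    (hGZK : rank_eq_analyticRank_of_analyticRank_le_one) (hmod : hasEntireLFunction_rat)
    (hmodD : nonempty_modularParametrizationData) (hDel3 : Delbourgo2002.mainTheorem_three)
    (hkato : ∀ (V : WeierstrassCurve ℚ) [V.IsElliptic] [V.IsGloballyMinimal] (κ : ZpExtension ℚ 3)
      (γ : Field.absoluteGaloisGroup ℚ) (N : ℕ) [NeZero N] (f : CuspForm (Gamma0 N) 2),
      kato_divisibility V 3 (κ := κ) (γ := γ) (f := f))
    (hR : ∀ (V : WeierstrassCurve ℚ) [V.IsElliptic] [V.IsGloballyMinimal] (N : ℕ) [NeZero N]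
      (f : CuspForm (Gamma0 N) 2), padicLFunction_ne_zero (W := V) (p := 3) (f := f))
    (hc : N10.CellGordTwo W 3) (hcm : ¬ W.HasCM) (hr : W.analyticRank = 0)
    (hBC : GordTwistBaseChangeLowerOddAt W 3)
    (hU : ∀ (V : WeierstrassCurve ℚ) [V.IsElliptic] [V.IsGloballyMinimal] {N : ℕ} [NeZero N]
      (f : CuspForm (Gamma0 N) 2) (ϖ : ℚ),
      (∃ C : VariableChange ℚ, C • V.quadraticTwist (-(3 : ℚ)) = W) →
      GoodOrd V 3 → IsNewformOf V f → (ϖ : ℝ) * V.imaginaryPeriodRat = minusPeriod f →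
      ∃ b : IwasawaAlgebra 3, iwasawaToPowerSeries 3 b =
        PowerSeries.C ((ϖ : ℚ) : ℚ_[3]) * padicLFunctionMinusBranch f (unitRoot V 3 : ℚ_[3]) (3 / 2) ∧
        HasUnitContent b) :
    MissingLowerBoundAt W 3 :=
  missingLowerBoundAt_cellGordTwo_rankZero_of_baseChangeOdd_of_hasUnitContent (p := 3) hDelG hGZK hmod hmodD
    hkato hR (fun _ _ D hκ hγ ↦ hc.2.2.1.isTorsion_three_of_delbourgo2002 hDel3 hc.2.1 hcm hκ hγ D)
    hc (by norm_num) hr hBC hU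

end DoorsFactsThree

end Summit.BirchSwinnertonDyer.BirchSwinnertonDyer.Theorems.AdditiveBranchIMCTwistField

end
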